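import Mathlib
import Literature.Analysis.Complex.LogDerivZerosDisc
import Literature.Analysis.Complex.HolomorphicParametricIntegral
import HarnessLib

/-!
# Nevanlinna's holomorphic multiplier lemma (Calegari–Dimitrov–Tang, Lemma 2.3.1)

`Literature/Analysis/Complex/NevanlinnaMultiplier.lean`. Everything here is PROVED (no definition,
no named fact). The main result is the classical lemma of R. Nevanlinna in the holomorphic form in
which F. Calegari, V. Dimitrov and Y. Tang state, prove and use it in *The unbounded denominators
conjecture* (J. Amer. Math. Soc. **38** (2025), 627–702; arXiv:2109.09040), Lemma 2.3.1 of the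
published numbering — the bridge from the "meromorphic form" (Lemma 2.0.4) of their arithmetic
holonomy bound to its final form (Theorem 2.0.1), where a supremum over the unit circle is traded
for the Nevanlinna mean proximity `∫_𝕋 log⁺|g|`:

> **Lemma 2.3.1 (Nevanlinna).** Let `g : D̄(0,1) → ℂ` be holomorphic (on some open neighbourhood
> of the closed unit disc) and `ε > 0`. Then there is a quotient representation `g = hg/h` with
> `h : D̄(0,1) → ℂ` holomorphic, `h(0) = 1` and
> `max { sup_𝕋 log|h|, sup_𝕋 log|hg| } ≤ ∫_𝕋 log⁺|g| μ_Haar + ε`.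

This is `exists_holomorphic_multiplier` below (`∫_𝕋 log⁺|g| μ_Haar` is
`Real.circleAverage (fun w ↦ log⁺ ‖g w‖) 0 1`). The proof is the printed one, rearranged so that no
boundary limit `r → 1⁻` is needed: we FIRST choose the rescaling radius `ρ = 1 + δ` so that `g`
has no zeros on `|z| = ρ` (zeros are isolated) and `∫_{|z|=ρ} log⁺|g| ≤ ∫_𝕋 log⁺|g| + ε`
(continuity of the mean proximity in the radius), and then run Nevanlinna's construction for
`g̃(z) = g(ρ z)` directly at radius `1`:

1. `exists_eq_blaschke_mul` — divide out the zeros of `g̃` in the open disc by a finite Blaschke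
   product `B` (`|B| = 1` on `𝕋`, `|B| ≤ 1` on `D̄`), `g̃ = B · G` with `G` holomorphic and
   zero-free about `D̄` (Mathlib's extraction of zeros, via
   `Literature.Analysis.Complex.exists_eq_prod_pow_sub_mul`, and `z − u = B_u(z)(1 − ū z)`).
2. `log_norm_le_circleAverage_poissonKernel_mul_posLog` — Poisson–Jensen inequality
   `log|g̃(z)| ≤ ∫_𝕋 P(z, w) log⁺|g̃(w)| μ_Haar(w)` for `|z| < 1`: `log|g̃| ≤ log|G|`, Poisson's
   formula for the harmonic `log|G|` (Mathlib), and `log|G| = log|g̃| ≤ log⁺|g̃|` on `𝕋`.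
3. `differentiableOn_herglotzIntegral` & co. — the Herglotz–Riesz integral
   `P(z) = ∫_𝕋 (w + z)/(w − z) φ(w) μ_Haar(w)` of the continuous boundary function
   `φ = log⁺|g̃|` is holomorphic in `|z| < 1`, has real part the Poisson integral of `φ` (`≥ 0`)
   and `P(0) = ∫_𝕋 φ`.
4. `exists_multiplier_on_ball` — `h̃ = exp(∫_𝕋 φ − P)` is holomorphic on the open disc with
   `h̃(0) = 1`, `log|h̃| ≤ ∫_𝕋 φ` and `log|h̃ g̃| ≤ ∫_𝕋 φ` there (CDT display (2.10) and the lines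
   after it: "This constructs the desired quotient representation except on the open disc").
5. `h(z) = h̃(z/ρ)` ("The full statement bootstraps from this … this is where the `ε > 0`
   emerges").
6. `le_of_forall_multiplier_bound` — the opening sentence of CDT §2.3: a bound valid for every
   multiplier `h` (the "meromorphic form", Lemma 2.0.4) yields the bound by the mean proximity
   (Theorem 2.0.1), letting `ε → 0`.
7. `circleAverage_posLog_norm_le_of_multiplier` — the converse inequality of CDT Remark 2.3.2
   (`max{sup_𝕋 log|h|, sup_𝕋 log|hg|} ≥ ∫_𝕋 log⁺|g|` for every multiplier `h`, from Jensen's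
   formula `∫_𝕋 log|h| ≥ log|h(0)| = 0`), showing the necessity of the `ε` and the equivalence of
   Theorem 2.0.1 with Lemma 2.0.4.

## References

* [CalegariDimitrovTang2025] F. Calegari, V. Dimitrov, Y. Tang, The unbounded denominators
  conjecture, J. Amer. Math. Soc. 38 (2025), no. 3, 627–702, §2.3, Lemma 2.3.1 and its proof;
  arXiv:2109.09040.
* R. Nevanlinna, *Eindeutige analytische Funktionen*, 2nd ed., Springer 1953, §VII.1.4 (Theorem on
  p. 187); G. M. Goluzin, *Geometric theory of functions of a complex variable*, AMS 1969, §VII.5.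
-/

noncomputable section

open Complex Metric Real Set Filter Topology MeasureTheory InnerProductSpace

namespace Literature.Analysis.Complex

/-! ### 1. Blaschke factors -/

/-- `|z − u|² − |1 − ū z|² = (|z|² − 1)(1 − |u|²)`. [folklore] -/
theorem norm_sub_sq_sub_norm_one_sub_conj_mul_sq (u z : ℂ) :
    ‖z - u‖ ^ 2 - ‖1 - (starRingEnd ℂ) u * z‖ ^ 2 = (‖z‖ ^ 2 - 1) * (1 - ‖u‖ ^ 2) := by
  simp only [← Complex.normSq_eq_norm_sq, Complex.normSq_apply, Complex.sub_re, Complex.sub_im,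
    Complex.mul_re, Complex.mul_im, Complex.one_re, Complex.one_im, Complex.conj_re,
    Complex.conj_im]
  ring

/-- For `|u| < 1` and `|z| ≤ 1`, `1 − ū z ≠ 0`. [folklore] -/
theorem one_sub_conj_mul_ne_zero {u z : ℂ} (hu : ‖u‖ < 1) (hz : ‖z‖ ≤ 1) :
    1 - (starRingEnd ℂ) u * z ≠ 0 := by
  intro h
  have h1 : ‖(starRingEnd ℂ) u * z‖ = 1 := by
    rw [← sub_eq_zero.mp h]
    simp
  rw [norm_mul, Complex.norm_conj] at h1
  nlinarith [norm_nonneg u, norm_nonneg z, mul_le_mul_of_nonneg_left hz (norm_nonneg u)]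

/-- The Blaschke factor `(z − u)/(1 − ū z)`, `|u| < 1`, has modulus `1` on the unit circle.
[folklore] -/
theorem norm_blaschkeFactor_eq_one {u z : ℂ} (hu : ‖u‖ < 1) (hz : ‖z‖ = 1) :
    ‖(z - u) / (1 - (starRingEnd ℂ) u * z)‖ = 1 := by
  have hne := one_sub_conj_mul_ne_zero hu hz.le
  have hsq := norm_sub_sq_sub_norm_one_sub_conj_mul_sq u z
  rw [hz, one_pow, sub_self, zero_mul, sub_eq_zero] at hsq
  have : ‖z - u‖ = ‖1 - (starRingEnd ℂ) u * z‖ := by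
    have h1 := norm_nonneg (z - u)
    have h2 := norm_nonneg (1 - (starRingEnd ℂ) u * z)
    nlinarith
  rw [norm_div, this, div_self (norm_ne_zero_iff.mpr hne)]

/-- The Blaschke factor `(z − u)/(1 − ū z)`, `|u| < 1`, has modulus `≤ 1` on the closed unit disc.
[folklore] -/
theorem norm_blaschkeFactor_le_one {u z : ℂ} (hu : ‖u‖ < 1) (hz : ‖z‖ ≤ 1) :
    ‖(z - u) / (1 - (starRingEnd ℂ) u * z)‖ ≤ 1 := by
  have hne := one_sub_conj_mul_ne_zero hu hz
  have hsq := norm_sub_sq_sub_norm_one_sub_conj_mul_sq u z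
  have hle : ‖z - u‖ ^ 2 ≤ ‖1 - (starRingEnd ℂ) u * z‖ ^ 2 := by
    have h1 : (‖z‖ ^ 2 - 1) * (1 - ‖u‖ ^ 2) ≤ 0 :=
      mul_nonpos_of_nonpos_of_nonneg (by nlinarith [norm_nonneg z]) (by nlinarith [norm_nonneg u])
    linarith
  rw [norm_div, div_le_one (norm_pos_iff.mpr hne)]
  exact (pow_le_pow_iff_left₀ (norm_nonneg _) (norm_nonneg _) two_ne_zero).mp hle

/-! ### 2. Dividing out the zeros: Blaschke factorisation -/

/-- **Dividing out the zero at the centre.** If `f` is holomorphic about the closed disc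
`|z| ≤ R` and not identically zero there, then `f(z) = zⁿ f₁(z)` with `f₁` holomorphic about the
closed disc and `f₁(0) ≠ 0` (`n` = the order of `f` at `0`). [folklore] -/
theorem exists_eq_pow_mul_of_analyticOnNhd {f : ℂ → ℂ} {R : ℝ}
    (hf : AnalyticOnNhd ℂ f (closedBall 0 R)) (hne : ∃ z ∈ closedBall (0 : ℂ) R, f z ≠ 0) :
    ∃ (n : ℕ) (f₁ : ℂ → ℂ), AnalyticOnNhd ℂ f₁ (closedBall 0 R) ∧ f₁ 0 ≠ 0 ∧
      ∀ z, f z = z ^ n * f₁ z := by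
  obtain ⟨z₀, hz₀, hfz₀⟩ := hne
  have hR : 0 ≤ R := by simpa using nonempty_closedBall.1 ⟨z₀, hz₀⟩
  have h0 : (0 : ℂ) ∈ closedBall (0 : ℂ) R := mem_closedBall_self hR
  have hf0 : AnalyticAt ℂ f 0 := hf 0 h0
  -- the order of `f` at `0` is finite
  have hntop : analyticOrderAt f 0 ≠ ⊤ := by
    intro htop
    have h := hf.eqOn_zero_of_preconnected_of_eventuallyEq_zero
      (convex_closedBall (0 : ℂ) R).isPreconnected h0 (analyticOrderAt_eq_top.mp htop) hz₀
    exact hfz₀ h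
  obtain ⟨n, hn⟩ := ENat.ne_top_iff_exists.mp hntop
  obtain ⟨g₀, hg₀, hg₀0, hloc⟩ := (hf0.analyticOrderAt_eq_natCast (n := n)).mp hn.symm
  simp only [sub_zero, smul_eq_mul] at hloc
  classical
  refine ⟨n, fun z ↦ if z = 0 then g₀ 0 else f z / z ^ n, ?_, by simpa using hg₀0, ?_⟩
  · intro z hz
    by_cases hz0 : z = 0
    · subst hz0
      refine hg₀.congr ?_
      filter_upwards [hloc] with w hw
      by_cases hw0 : w = 0
      · simp [hw0]
      · simp only [hw0, if_false, hw]
        field_simp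
    · have hopen : ∀ᶠ w in 𝓝 z, w ≠ 0 := isOpen_ne.mem_nhds hz0
      refine (((hf z hz).div (analyticAt_id.pow n) (pow_ne_zero n hz0))).congr ?_
      filter_upwards [hopen] with w hw
      simp [hw]
  · intro z
    by_cases hz0 : z = 0
    · subst hz0
      have := hloc.self_of_nhds
      simp only [if_true]
      rw [this]
    · simp only [hz0, if_false]
      rw [mul_div_cancel₀ _ (pow_ne_zero n hz0)]

/-- For a function holomorphic about a closed disc, a point of the support of its divisor is a
zero. [folklore] -/
theorem eq_zero_of_mem_support_divisor {f : ℂ → ℂ} {U : Set ℂ} (hf : AnalyticOnNhd ℂ f U) {u : ℂ}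
    (hu : u ∈ (MeromorphicOn.divisor f U).support) : u ∈ U ∧ f u = 0 := by
  have huU : u ∈ U := (MeromorphicOn.divisor f U).supportWithinDomain hu
  refine ⟨huU, ?_⟩
  by_contra hne
  rw [Function.mem_support, hf.meromorphicOn.divisor_apply huU,
    (hf u huU).meromorphicOrderAt_eq, (hf u huU).analyticOrderAt_eq_zero.mpr hne] at hu
  simp at hu

/-- **Blaschke factorisation.** Let `f` be holomorphic about the closed unit disc, without zeros
on the unit circle. Then `f = B · G` on `|z| ≤ 1`, where `B` (the finite Blaschke product of the
zeros of `f` in the open disc) satisfies `|B| = 1` on `|z| = 1` and `|B| ≤ 1` on `|z| ≤ 1`, and `G`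
is holomorphic and zero-free about the closed unit disc. [folklore] -/
theorem exists_eq_blaschke_mul {f : ℂ → ℂ} (hf : AnalyticOnNhd ℂ f (closedBall 0 1))
    (hf0 : ∀ z ∈ sphere (0 : ℂ) 1, f z ≠ 0) :
    ∃ (B G : ℂ → ℂ), AnalyticOnNhd ℂ G (closedBall 0 1) ∧ (∀ z ∈ closedBall (0 : ℂ) 1, G z ≠ 0) ∧
      (∀ z ∈ sphere (0 : ℂ) 1, ‖B z‖ = 1) ∧ (∀ z ∈ closedBall (0 : ℂ) 1, ‖B z‖ ≤ 1) ∧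
      ∀ z ∈ closedBall (0 : ℂ) 1, f z = B z * G z := by
  classical
  have h1s : (1 : ℂ) ∈ sphere (0 : ℂ) 1 := by simp
  obtain ⟨n, f₁, hf₁, hf₁0, hff₁⟩ :=
    exists_eq_pow_mul_of_analyticOnNhd hf ⟨1, sphere_subset_closedBall h1s, hf0 1 h1s⟩
  obtain ⟨G₀, hG₀, hG₀0, hfac⟩ := exists_eq_prod_pow_sub_mul one_pos le_rfl hf₁ hf₁0
  set D := MeromorphicOn.divisor f₁ (closedBall (0 : ℂ) 1) with hD
  set S := (D.finiteSupport (isCompact_closedBall (0 : ℂ) 1)).toFinset with hS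
  -- the zeros of `f₁` extracted lie in the open disc
  have hS1 : ∀ u ∈ S, ‖u‖ < 1 := by
    intro u hu
    rw [hS, Finite.mem_toFinset] at hu
    obtain ⟨huU, hu0⟩ := eq_zero_of_mem_support_divisor hf₁ hu
    have hu1 : ‖u‖ ≤ 1 := by simpa using huU
    rcases hu1.lt_or_eq with h | h
    · exact h
    · exact absurd (by rw [hff₁ u, hu0, mul_zero]) (hf0 u (by simpa using h))
  refine ⟨fun z ↦ z ^ n * ∏ u ∈ S, ((z - u) / (1 - (starRingEnd ℂ) u * z)) ^ (D u).toNat,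
    fun z ↦ G₀ z * ∏ u ∈ S, (1 - (starRingEnd ℂ) u * z) ^ (D u).toNat, ?_, ?_, ?_, ?_, ?_⟩
  · -- `G` holomorphic
    intro z hz
    refine (hG₀ z hz).mul (Differentiable.analyticAt ?_ z)
    fun_prop
  · -- `G` zero-free on the closed disc
    intro z hz
    have hz1 : ‖z‖ ≤ 1 := by simpa using hz
    refine mul_ne_zero (hG₀0 z hz) (Finset.prod_ne_zero_iff.mpr fun u hu ↦ ?_)
    exact pow_ne_zero _ (one_sub_conj_mul_ne_zero (hS1 u hu) hz1)
  · -- `|B| = 1` on the circle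
    intro z hz
    have hz1 : ‖z‖ = 1 := by simpa using hz
    rw [norm_mul, norm_pow, hz1, one_pow, one_mul, norm_prod]
    refine Finset.prod_eq_one fun u hu ↦ ?_
    rw [norm_pow, norm_blaschkeFactor_eq_one (hS1 u hu) hz1, one_pow]
  · -- `|B| ≤ 1` on the closed disc
    intro z hz
    have hz1 : ‖z‖ ≤ 1 := by simpa using hz
    rw [norm_mul, norm_pow, norm_prod]
    refine mul_le_one₀ (pow_le_one₀ (norm_nonneg z) hz1) (Finset.prod_nonneg fun _ _ ↦ norm_nonneg _)
      (Finset.prod_le_one (fun _ _ ↦ norm_nonneg _) fun u hu ↦ ?_)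
    rw [norm_pow]
    exact pow_le_one₀ (norm_nonneg _) (norm_blaschkeFactor_le_one (hS1 u hu) hz1)
  · -- `f = B G`
    intro z hz
    have hz1 : ‖z‖ ≤ 1 := by simpa using hz
    rw [hff₁ z, hfac z hz]
    have key : ∀ u ∈ S, ((z - u) / (1 - (starRingEnd ℂ) u * z)) ^ (D u).toNat *
        (1 - (starRingEnd ℂ) u * z) ^ (D u).toNat = (z - u) ^ (D u).toNat := by
      intro u hu
      rw [← mul_pow, div_mul_cancel₀ _ (one_sub_conj_mul_ne_zero (hS1 u hu) hz1)]
    calc z ^ n * ((∏ u ∈ S, (z - u) ^ (D u).toNat) * G₀ z)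
        = z ^ n * G₀ z * ∏ u ∈ S, ((z - u) / (1 - (starRingEnd ℂ) u * z)) ^ (D u).toNat *
            (1 - (starRingEnd ℂ) u * z) ^ (D u).toNat := by
          rw [Finset.prod_congr rfl key]
          ring
      _ = z ^ n * (∏ u ∈ S, ((z - u) / (1 - (starRingEnd ℂ) u * z)) ^ (D u).toNat) *
            (G₀ z * ∏ u ∈ S, (1 - (starRingEnd ℂ) u * z) ^ (D u).toNat) := by
          rw [Finset.prod_mul_distrib]
          ring

/-! ### 3. The Poisson–Jensen inequality -/

/-- The Poisson kernel `P(z, w) = (|w|² − |z|²)/|w − z|²` of the unit disc is continuous in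
`w ∈ 𝕋` for `|z| < 1`. [folklore] -/
theorem continuousOn_poissonKernel_sphere {z : ℂ} (hz : z ∈ ball (0 : ℂ) 1) :
    ContinuousOn (poissonKernel 0 z) (sphere (0 : ℂ) 1) := by
  have hz' : ‖z‖ < 1 := by simpa using hz
  have hne : ∀ w ∈ sphere (0 : ℂ) 1, w - 0 - (z - 0) ≠ 0 := by
    intro w hw h0
    have hw' : ‖w‖ = 1 := by simpa using hw
    simp only [sub_zero] at h0
    rw [sub_eq_zero.mp h0] at hw'
    linarith
  intro w hw
  have h := hne w hw
  unfold poissonKernel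
  refine ContinuousAt.continuousWithinAt ?_
  refine ContinuousAt.div (by fun_prop) (by fun_prop) (pow_ne_zero 2 (norm_ne_zero_iff.mpr h))

/-- The Poisson kernel of the unit disc is nonnegative (`|z| < 1`, `|w| = 1`). [folklore] -/
theorem poissonKernel_nonneg {z w : ℂ} (hz : z ∈ ball (0 : ℂ) 1) (hw : w ∈ sphere (0 : ℂ) 1) :
    0 ≤ poissonKernel 0 z w := by
  have hz' : ‖z‖ < 1 := by simpa using hz
  have h := le_re_herglotzRieszKernel (R := 1) (c := 0) hw hz
  rw [poissonKernel_eq_re_herglotzRieszKernel, Function.comp_apply, herglotzRieszKernel]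
  refine le_trans ?_ h
  simp only [sub_zero]
  exact div_nonneg (by linarith) (by positivity)

/-- **Poisson–Jensen inequality.** For `f` holomorphic about the closed unit disc without zeros on
the unit circle and `|z| < 1`:
`log|f(z)| ≤ ∫_𝕋 P(z, w) log⁺|f(w)| μ_Haar(w)`, `P` the Poisson kernel. Proof: `f = B G`
(Blaschke factorisation), `log|f(z)| ≤ log|G(z)| = ∫ P(z,·) log|G|` (Poisson's formula for the
harmonic `log|G|`) `= ∫ P(z,·) log|f| ≤ ∫ P(z,·) log⁺|f|`.
[cite: CalegariDimitrovTang2025, proof of Lemma 2.3.1 (display (2.10))] -/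
theorem log_norm_le_circleAverage_poissonKernel_mul_posLog {f : ℂ → ℂ}
    (hf : AnalyticOnNhd ℂ f (closedBall 0 1)) (hf0 : ∀ z ∈ sphere (0 : ℂ) 1, f z ≠ 0)
    {z : ℂ} (hz : z ∈ ball (0 : ℂ) 1) :
    Real.log ‖f z‖ ≤ circleAverage (fun w ↦ poissonKernel 0 z w * log⁺ ‖f w‖) 0 1 := by
  have hzc : z ∈ closedBall (0 : ℂ) 1 := ball_subset_closedBall hz
  have hfc : ContinuousOn f (sphere (0 : ℂ) 1) := fun w hw ↦
    (hf w (sphere_subset_closedBall hw)).continuousAt.continuousWithinAt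
  have hPc := continuousOn_poissonKernel_sphere hz
  have hRHS0 : 0 ≤ circleAverage (fun w ↦ poissonKernel 0 z w * log⁺ ‖f w‖) 0 1 :=
    circleAverage_nonneg_of_nonneg fun w hw ↦
      mul_nonneg (poissonKernel_nonneg hz (by simpa using hw)) posLog_nonneg
  by_cases hfz : f z = 0
  · simpa [hfz] using hRHS0
  obtain ⟨B, G, hG, hG0, hB1, hBle, hfBG⟩ := exists_eq_blaschke_mul hf hf0
  have hBz : B z ≠ 0 := by
    intro h0
    exact hfz (by rw [hfBG z hzc, h0, zero_mul])
  -- `log |f(z)| ≤ log |G(z)|`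
  have h1 : Real.log ‖f z‖ ≤ Real.log ‖G z‖ := by
    rw [hfBG z hzc, norm_mul, Real.log_mul (norm_ne_zero_iff.mpr hBz) (norm_ne_zero_iff.mpr (hG0 z hzc))]
    have : Real.log ‖B z‖ ≤ 0 := Real.log_nonpos (norm_nonneg _) (hBle z hzc)
    linarith
  -- Poisson's formula for the harmonic function `log |G|`
  have hharm : HarmonicOnNhd (fun w ↦ Real.log ‖G w‖) (closedBall (0 : ℂ) 1) := fun w hw ↦
    (hG w hw).harmonicAt_log_norm (hG0 w hw)
  have hP := hharm.circleAverage_poissonKernel_smul hz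
  -- comparison of the integrands on the circle
  have hGc : ContinuousOn (fun w ↦ Real.log ‖G w‖) (sphere (0 : ℂ) 1) := by
    refine ContinuousOn.log ?_ fun w hw ↦ norm_ne_zero_iff.mpr (hG0 w (sphere_subset_closedBall hw))
    exact continuous_norm.comp_continuousOn fun w hw ↦
      (hG w (sphere_subset_closedBall hw)).continuousAt.continuousWithinAt
  have hi1 : CircleIntegrable (poissonKernel 0 z • fun w ↦ Real.log ‖G w‖) 0 1 :=
    (hPc.smul hGc).circleIntegrable zero_le_one
  have hi2 : CircleIntegrable (fun w ↦ poissonKernel 0 z w * log⁺ ‖f w‖) 0 1 := by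
    refine ContinuousOn.circleIntegrable zero_le_one (hPc.mul ?_)
    exact (by fun_prop : Continuous fun x : ℝ ↦ log⁺ x).comp_continuousOn
      (continuous_norm.comp_continuousOn hfc)
  have h2 : circleAverage (poissonKernel 0 z • fun w ↦ Real.log ‖G w‖) 0 1 ≤
      circleAverage (fun w ↦ poissonKernel 0 z w * log⁺ ‖f w‖) 0 1 := by
    refine circleAverage_mono hi1 hi2 fun w hw ↦ ?_
    rw [abs_one] at hw
    have hw1 : ‖w‖ = 1 := by simpa using hw
    simp only [Pi.smul_apply', smul_eq_mul]
    refine mul_le_mul_of_nonneg_left ?_ (poissonKernel_nonneg hz hw)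
    have hfw : ‖f w‖ = ‖G w‖ := by
      rw [hfBG w (sphere_subset_closedBall hw), norm_mul, hB1 w hw, one_mul]
    rw [← hfw, posLog_apply]
    exact le_max_right _ _
  calc Real.log ‖f z‖ ≤ Real.log ‖G z‖ := h1
    _ = circleAverage (poissonKernel 0 z • fun w ↦ Real.log ‖G w‖) 0 1 := hP.symm
    _ ≤ _ := h2

/-! ### 4. The Herglotz–Riesz integral of a continuous boundary function -/

/-- The Herglotz–Riesz integral `P(z) = ∫_𝕋 (w + z)/(w − z) φ(w) μ_Haar(w)` of a continuous
`φ : 𝕋 → ℝ` is holomorphic on `|z| < 1` (holomorphic dependence of a dominated parameter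
integral, `Literature.Analysis.Complex.differentiableOn_integral_of_dominated`). [folklore] -/
theorem differentiableOn_herglotzIntegral {φ : ℂ → ℝ} (hφ : ContinuousOn φ (sphere (0 : ℂ) 1)) :
    DifferentiableOn ℂ
      (fun z ↦ circleAverage (fun w ↦ (w + z) / (w - z) * (φ w : ℂ)) 0 1) (ball (0 : ℂ) 1) := by
  -- the parametrised integrand
  set F : ℂ → ℝ → ℂ := fun z θ ↦
    (circleMap 0 1 θ + z) / (circleMap 0 1 θ - z) * (φ (circleMap 0 1 θ) : ℂ) with hF
  have hsph : ∀ θ : ℝ, circleMap 0 1 θ ∈ sphere (0 : ℂ) 1 := fun θ ↦ circleMap_mem_sphere 0 zero_le_one θ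
  have hne : ∀ θ : ℝ, ∀ z ∈ ball (0 : ℂ) 1, circleMap 0 1 θ - z ≠ 0 := by
    intro θ z hz h0
    have hz' : ‖z‖ < 1 := by simpa using hz
    have h1 : ‖circleMap 0 1 θ‖ = 1 := by simp
    rw [sub_eq_zero.mp h0] at h1
    linarith
  have hφc : Continuous fun θ : ℝ ↦ (φ (circleMap 0 1 θ) : ℂ) :=
    Complex.continuous_ofReal.comp (hφ.comp_continuous (continuous_circleMap 0 1) hsph)
  -- rewrite the circle average as an integral over `(0, 2π]`
  have heq : (fun z ↦ circleAverage (fun w ↦ (w + z) / (w - z) * (φ w : ℂ)) 0 1) =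
      fun z ↦ ((2 * π)⁻¹ : ℝ) • ∫ θ in Ioc 0 (2 * π), F z θ := by
    funext z
    rw [circleAverage_def, intervalIntegral.integral_of_le two_pi_pos.le]
  rw [heq]
  refine DifferentiableOn.const_smul ?_ ((2 * π)⁻¹ : ℝ)
  obtain ⟨M, hM⟩ := (isCompact_sphere (0 : ℂ) 1).exists_bound_of_continuousOn hφ
  refine differentiableOn_integral_of_dominated (fun z hz ↦ ?_) (Eventually.of_forall fun θ ↦ ?_)
    fun z₀ hz₀ ↦ ?_
  · -- measurability in `θ`
    refine (Continuous.aestronglyMeasurable ?_)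
    simp only [hF]
    refine Continuous.mul (Continuous.div (by fun_prop) (by fun_prop) fun θ ↦ hne θ z hz) hφc
  · -- holomorphy in `z`
    simp only [hF]
    intro z hz
    have h := hne θ z hz
    refine DifferentiableAt.differentiableWithinAt ?_
    exact (DifferentiableAt.div (by fun_prop) (by fun_prop) h).mul (differentiableAt_const _)
  · -- local domination
    have hz₀' : ‖z₀‖ < 1 := by simpa using hz₀
    set r := (1 - ‖z₀‖) / 2 with hr
    have hr0 : 0 < r := by rw [hr]; linarith
    have hsub : ball z₀ r ⊆ ball (0 : ℂ) 1 := by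
      intro z hz
      have : ‖z - z₀‖ < r := by simpa [dist_eq_norm] using hz
      have h2 : ‖z‖ ≤ ‖z - z₀‖ + ‖z₀‖ := norm_le_norm_sub_add z z₀
      simp only [mem_ball, dist_zero_right]
      linarith
    refine ⟨r, hr0, hsub, fun _ ↦ 2 / r * |M|, integrable_const _, Eventually.of_forall fun θ z hz ↦ ?_⟩
    have hzlt : ‖z‖ < ‖z₀‖ + r := by
      have : ‖z - z₀‖ < r := by simpa [dist_eq_norm] using hz
      linarith [norm_le_norm_sub_add z z₀]
    have hden : r ≤ ‖circleMap 0 1 θ - z‖ := by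
      have h1 : ‖circleMap 0 1 θ‖ = 1 := by simp
      have h2 : ‖circleMap 0 1 θ‖ ≤ ‖circleMap 0 1 θ - z‖ + ‖z‖ := norm_le_norm_sub_add _ _
      rw [hr] at hzlt ⊢
      linarith
    have hnum : ‖circleMap 0 1 θ + z‖ ≤ 2 := by
      have h1 : ‖circleMap 0 1 θ‖ = 1 := by simp
      calc ‖circleMap 0 1 θ + z‖ ≤ ‖circleMap 0 1 θ‖ + ‖z‖ := norm_add_le _ _
        _ ≤ 2 := by rw [h1]; linarith [hr0]
    simp only [hF, norm_mul, norm_div, Complex.norm_real, Real.norm_eq_abs]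
    have hφM : |φ (circleMap 0 1 θ)| ≤ |M| := (hM _ (hsph θ)).trans (le_abs_self M)
    calc ‖circleMap 0 1 θ + z‖ / ‖circleMap 0 1 θ - z‖ * |φ (circleMap 0 1 θ)|
        ≤ 2 / r * |M| := by
          have hq : ‖circleMap 0 1 θ + z‖ / ‖circleMap 0 1 θ - z‖ ≤ 2 / r :=
            div_le_div₀ zero_le_two hnum hr0 hden
          exact mul_le_mul hq hφM (abs_nonneg _) (by positivity)

/-- The Herglotz–Riesz kernel `(w + z)/(w − z)` times a continuous boundary function is continuous
on the circle (`|z| < 1`). [folklore] -/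
theorem continuousOn_herglotz_mul {φ : ℂ → ℝ} (hφ : ContinuousOn φ (sphere (0 : ℂ) 1)) {z : ℂ}
    (hz : z ∈ ball (0 : ℂ) 1) :
    ContinuousOn (fun w ↦ (w + z) / (w - z) * (φ w : ℂ)) (sphere (0 : ℂ) 1) := by
  have hz' : ‖z‖ < 1 := by simpa using hz
  have hne : ∀ w ∈ sphere (0 : ℂ) 1, w - z ≠ 0 := by
    intro w hw h0
    have hw' : ‖w‖ = 1 := by simpa using hw
    rw [sub_eq_zero.mp h0] at hw'
    linarith
  refine ContinuousOn.mul ?_ (Complex.continuous_ofReal.comp_continuousOn hφ)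
  exact (continuousOn_id.add continuousOn_const).div (continuousOn_id.sub continuousOn_const) hne

/-- The real part of the Herglotz–Riesz integral is the Poisson integral:
`Re P(z) = ∫_𝕋 P(z, w) φ(w) μ_Haar(w)`. [folklore] -/
theorem re_herglotzIntegral {φ : ℂ → ℝ} (hφ : ContinuousOn φ (sphere (0 : ℂ) 1)) {z : ℂ}
    (hz : z ∈ ball (0 : ℂ) 1) :
    (circleAverage (fun w ↦ (w + z) / (w - z) * (φ w : ℂ)) 0 1).re =
      circleAverage (fun w ↦ poissonKernel 0 z w * φ w) 0 1 := by
  have hint := (continuousOn_herglotz_mul hφ hz).circleIntegrable zero_le_one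
  have key := ContinuousLinearMap.circleAverage_comp_comm Complex.reCLM hint
  rw [Complex.reCLM_apply] at key
  rw [← key]
  apply circleAverage_congr_sphere
  intro w hw
  simp only [Function.comp_apply, Complex.reCLM_apply, Complex.mul_re, Complex.ofReal_re,
    Complex.ofReal_im, mul_zero, sub_zero]
  congr 1
  rw [poissonKernel_eq_re_herglotzRieszKernel, Function.comp_apply, herglotzRieszKernel]
  simp

/-- The value of the Herglotz–Riesz integral at the centre is the mean of the (continuous)
boundary function: `P(0) = ∫_𝕋 φ μ_Haar`. [folklore] -/
theorem herglotzIntegral_zero {φ : ℂ → ℝ} (hφ : ContinuousOn φ (sphere (0 : ℂ) 1)) :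
    circleAverage (fun w ↦ (w + 0) / (w - 0) * (φ w : ℂ)) 0 1 = ((circleAverage φ 0 1 : ℝ) : ℂ) := by
  have h1 : circleAverage (fun w ↦ (w + 0) / (w - 0) * (φ w : ℂ)) 0 1 =
      circleAverage (fun w ↦ (φ w : ℂ)) 0 1 := by
    apply circleAverage_congr_sphere
    intro w hw
    have hw0 : w ≠ 0 := by
      rintro rfl
      simp at hw
    simp [div_self hw0]
  rw [h1]
  have hint : CircleIntegrable φ 0 1 := by
    refine ContinuousOn.circleIntegrable zero_le_one ?_
    simpa using hφ
  simpa [Function.comp_def] using ContinuousLinearMap.circleAverage_comp_comm Complex.ofRealCLM hint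

/-! ### 5. The multiplier on the open disc (CDT (2.10)) -/

/-- **Nevanlinna's construction on the open disc** (CDT, proof of Lemma 2.3.1: "This constructs
the desired quotient representation except on the open disc"): for `f` holomorphic about the
closed unit disc without zeros on the unit circle, `h̃(z) = exp(∫_𝕋 log⁺|f| − P(z))`, `P` the
Herglotz–Riesz integral of `log⁺|f|`, is holomorphic on `|z| < 1` with `h̃(0) = 1`,
`log|h̃| ≤ ∫_𝕋 log⁺|f| μ_Haar` and `log|h̃ f| ≤ ∫_𝕋 log⁺|f| μ_Haar` on `|z| < 1`.
[cite: CalegariDimitrovTang2025, proof of Lemma 2.3.1] -/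
theorem exists_multiplier_on_ball {f : ℂ → ℂ} (hf : AnalyticOnNhd ℂ f (closedBall 0 1))
    (hf0 : ∀ z ∈ sphere (0 : ℂ) 1, f z ≠ 0) :
    ∃ h : ℂ → ℂ, DifferentiableOn ℂ h (ball 0 1) ∧ h 0 = 1 ∧
      ∀ z ∈ ball (0 : ℂ) 1, Real.log ‖h z‖ ≤ circleAverage (fun w ↦ log⁺ ‖f w‖) 0 1 ∧
        Real.log ‖h z * f z‖ ≤ circleAverage (fun w ↦ log⁺ ‖f w‖) 0 1 := by
  set φ : ℂ → ℝ := fun w ↦ log⁺ ‖f w‖ with hφ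
  have hfc : ContinuousOn f (sphere (0 : ℂ) 1) := fun w hw ↦
    (hf w (sphere_subset_closedBall hw)).continuousAt.continuousWithinAt
  have hφc : ContinuousOn φ (sphere (0 : ℂ) 1) :=
    (by fun_prop : Continuous fun x : ℝ ↦ log⁺ x).comp_continuousOn
      (continuous_norm.comp_continuousOn hfc)
  set m : ℝ := circleAverage φ 0 1 with hm
  have hm0 : 0 ≤ m := circleAverage_nonneg_of_nonneg fun _ _ ↦ posLog_nonneg
  set P : ℂ → ℂ := fun z ↦ circleAverage (fun w ↦ (w + z) / (w - z) * (φ w : ℂ)) 0 1 with hP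
  have hPd : DifferentiableOn ℂ P (ball 0 1) := differentiableOn_herglotzIntegral hφc
  have hP0 : P 0 = (m : ℂ) := by rw [hP, hm]; exact herglotzIntegral_zero hφc
  have hPre : ∀ z ∈ ball (0 : ℂ) 1,
      (P z).re = circleAverage (fun w ↦ poissonKernel 0 z w * φ w) 0 1 := fun z hz ↦
    re_herglotzIntegral hφc hz
  have hU0 : ∀ z ∈ ball (0 : ℂ) 1, 0 ≤ circleAverage (fun w ↦ poissonKernel 0 z w * φ w) 0 1 :=
    fun z hz ↦ circleAverage_nonneg_of_nonneg fun w hw ↦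
      mul_nonneg (poissonKernel_nonneg hz (by simpa using hw)) posLog_nonneg
  refine ⟨fun z ↦ Complex.exp ((m : ℂ) - P z), ?_, ?_, fun z hz ↦ ⟨?_, ?_⟩⟩
  · exact ((differentiableOn_const _).sub hPd).cexp
  · simp [hP0]
  · rw [Complex.norm_exp, Real.log_exp, Complex.sub_re, Complex.ofReal_re, hPre z hz]
    linarith [hU0 z hz]
  · by_cases hfz : f z = 0
    · simp [hfz, hm0]
    rw [norm_mul, Real.log_mul (by simp) (norm_ne_zero_iff.mpr hfz), Complex.norm_exp, Real.log_exp,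
      Complex.sub_re, Complex.ofReal_re, hPre z hz]
    linarith [log_norm_le_circleAverage_poissonKernel_mul_posLog hf hf0 hz]

/-! ### 6. Nevanlinna's lemma (CDT Lemma 2.3.1) -/

/-- **Nevanlinna's lemma on the holomorphic multiplier** (Calegari–Dimitrov–Tang, Lemma 2.3.1 of
the published version; R. Nevanlinna, *Eindeutige analytische Funktionen*, §VII.1.4): let `g` be
holomorphic on an open neighbourhood of the closed unit disc and `ε > 0`. Then there is a function
`h`, holomorphic on an open neighbourhood of the closed unit disc, with `h(0) = 1` and
`max { sup_𝕋 log|h|, sup_𝕋 log|h g| } ≤ ∫_𝕋 log⁺|g| μ_Haar + ε`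
(so that `g = hg/h` is a quotient of two holomorphic functions controlled on `𝕋` by the mean
proximity of `g`). [cite: CalegariDimitrovTang2025, Lemma 2.3.1] -/
theorem exists_holomorphic_multiplier {g : ℂ → ℂ} (hg : AnalyticOnNhd ℂ g (closedBall 0 1))
    {ε : ℝ} (hε : 0 < ε) :
    ∃ h : ℂ → ℂ, AnalyticOnNhd ℂ h (closedBall 0 1) ∧ h 0 = 1 ∧
      (∀ z ∈ sphere (0 : ℂ) 1,
        Real.log ‖h z‖ ≤ circleAverage (fun w ↦ log⁺ ‖g w‖) 0 1 + ε) ∧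
      ∀ z ∈ sphere (0 : ℂ) 1,
        Real.log ‖h z * g z‖ ≤ circleAverage (fun w ↦ log⁺ ‖g w‖) 0 1 + ε := by
  set m := circleAverage (fun w ↦ log⁺ ‖g w‖) 0 1 with hm
  have hm0 : 0 ≤ m := circleAverage_nonneg_of_nonneg fun _ _ ↦ posLog_nonneg
  /- The trivial case `g ≡ 0` on the closed disc: `h = 1`. -/
  by_cases htriv : ∀ z ∈ closedBall (0 : ℂ) 1, g z = 0
  · refine ⟨fun _ ↦ 1, fun z _ ↦ analyticAt_const, rfl, fun z hz ↦ ?_, fun z hz ↦ ?_⟩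
    · simp only [norm_one, Real.log_one]; linarith
    · rw [htriv z (sphere_subset_closedBall hz)]; simp only [mul_zero, norm_zero, Real.log_zero]; linarith
  push Not at htriv
  obtain ⟨z₁, hz₁, hgz₁⟩ := htriv
  /- Step A: a larger closed disc `|z| ≤ R₀`, `R₀ > 1`, about which `g` is holomorphic. -/
  obtain ⟨R₀, hR₀, hg'⟩ : ∃ R₀ > 1, AnalyticOnNhd ℂ g (closedBall 0 R₀) := by
    obtain ⟨δ, hδ, hδU⟩ := (isCompact_closedBall (0 : ℂ) 1).exists_thickening_subset_open
      (isOpen_analyticAt ℂ g) hg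
    rw [thickening_closedBall hδ zero_le_one] at hδU
    refine ⟨1 + δ / 2, by linarith, fun z hz ↦ hδU ?_⟩
    have : ‖z‖ ≤ 1 + δ / 2 := by simpa using hz
    simp only [mem_ball, dist_zero_right]
    linarith
  /- Step B: the zeros of `g` in `|z| ≤ R₀` are finite (divide out the zero at `0`, then the
  others). -/
  obtain ⟨n, g₁, hg₁, hg₁0, hgg₁⟩ := exists_eq_pow_mul_of_analyticOnNhd hg'
    ⟨z₁, closedBall_subset_closedBall hR₀.le hz₁, hgz₁⟩
  obtain ⟨G₀, -, hG₀0, hfac⟩ := exists_eq_prod_pow_sub_mul (zero_lt_one.trans hR₀) le_rfl hg₁ hg₁0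
  classical
  set S₀ := ((MeromorphicOn.divisor g₁ (closedBall (0 : ℂ) R₀)).finiteSupport
    (isCompact_closedBall (0 : ℂ) R₀)).toFinset with hS₀
  have hzeros : ∀ z ∈ closedBall (0 : ℂ) R₀, g z = 0 → z = 0 ∨ z ∈ S₀ := by
    intro z hz h0
    rw [hgg₁ z, hfac z hz, mul_eq_zero, mul_eq_zero] at h0
    rcases h0 with h0 | h0 | h0
    · exact Or.inl (pow_eq_zero_iff'.mp h0).1
    · right
      obtain ⟨u, hu, hu0⟩ := Finset.prod_eq_zero_iff.mp h0
      have : z = u := sub_eq_zero.mp (pow_eq_zero_iff'.mp hu0).1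
      rwa [this]
    · exact absurd h0 (hG₀0 z hz)
  /- Step C: continuity of `ρ ↦ m(ρ, g)` on `[0, R₀]`. -/
  have hgc : ContinuousOn g (closedBall (0 : ℂ) R₀) := fun z hz ↦ (hg' z hz).continuousAt.continuousWithinAt
  have hmc : ContinuousOn (fun ρ ↦ circleAverage (fun w ↦ log⁺ ‖g w‖) 0 ρ) (Icc 0 R₀) := by
    refine ContinuousOn.circleAverage ?_ fun r hr ↦ hr.1
    refine ((by fun_prop : Continuous fun x : ℝ ↦ log⁺ x).comp_continuousOn
      (continuous_norm.comp_continuousOn (hgc.mono ?_)))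
    intro z hz
    simp only [sub_zero, mem_setOf_eq, mem_Icc] at hz
    simpa using hz.2
  obtain ⟨δ, hδ, hδε⟩ := (Metric.continuousOn_iff.mp hmc) 1 ⟨zero_le_one, hR₀.le⟩ ε hε
  /- Step D: a radius `ρ ∈ (1, R₀)`, `δ`-close to `1`, avoiding the moduli of the zeros. -/
  have hlt : (1 : ℝ) < min R₀ (1 + δ) := lt_min hR₀ (by linarith)
  obtain ⟨ρ, hρ, hρS⟩ := (Set.Ioo_infinite hlt).exists_notMem_finset (S₀.image fun u ↦ ‖u‖)
  obtain ⟨hρ1, hρ2⟩ := hρ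
  have hρR₀ : ρ < R₀ := hρ2.trans_le (min_le_left _ _)
  have hρδ : ρ < 1 + δ := hρ2.trans_le (min_le_right _ _)
  have hρ0 : 0 < ρ := zero_lt_one.trans hρ1
  have hgρ : ∀ z : ℂ, ‖z‖ = ρ → g z ≠ 0 := by
    intro z hz h0
    have hzR : z ∈ closedBall (0 : ℂ) R₀ := by simpa using (hz.le.trans hρR₀.le)
    rcases hzeros z hzR h0 with h | h
    · rw [h, norm_zero] at hz; linarith
    · exact hρS (Finset.mem_image.mpr ⟨z, h, hz⟩)
  have hmρ : circleAverage (fun w ↦ log⁺ ‖g w‖) 0 ρ ≤ m + ε := by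
    have h := hδε ρ ⟨hρ0.le, hρR₀.le⟩ (by rw [dist_eq_norm, Real.norm_eq_abs, abs_lt]; constructor <;> linarith)
    rw [hm]
    have := (abs_lt.mp (by simpa [dist_eq_norm] using h)).2
    linarith
  /- Step E: the rescaled function `f(z) = g(ρ z)` on the closed unit disc. -/
  set f : ℂ → ℂ := fun z ↦ g (ρ * z) with hf
  have hfan : AnalyticOnNhd ℂ f (closedBall 0 1) := by
    intro z hz
    have hz1 : ‖z‖ ≤ 1 := by simpa using hz
    have hρz : (ρ : ℂ) * z ∈ closedBall (0 : ℂ) R₀ := by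
      simp only [mem_closedBall, dist_zero_right, norm_mul, Complex.norm_real, Real.norm_eq_abs,
        abs_of_pos hρ0]
      nlinarith
    exact (hg' _ hρz).comp_of_eq (analyticAt_const.mul analyticAt_id) rfl
  have hf0 : ∀ z ∈ sphere (0 : ℂ) 1, f z ≠ 0 := by
    intro z hz
    have hz1 : ‖z‖ = 1 := by simpa using hz
    refine hgρ _ ?_
    rw [norm_mul, Complex.norm_real, Real.norm_eq_abs, abs_of_pos hρ0, hz1, mul_one]
  have hmf : circleAverage (fun w ↦ log⁺ ‖f w‖) 0 1 = circleAverage (fun w ↦ log⁺ ‖g w‖) 0 ρ := by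
    simp only [circleAverage_def, hf]
    congr 2 with θ
    simp [circleMap_zero]
  obtain ⟨h₀, hh₀d, hh₀0, hh₀⟩ := exists_multiplier_on_ball hfan hf0
  /- Step F: undo the rescaling, `h(z) = h₀(z/ρ)`. -/
  have hball : ∀ z ∈ closedBall (0 : ℂ) 1, (ρ : ℂ)⁻¹ * z ∈ ball (0 : ℂ) 1 := by
    intro z hz
    have hz1 : ‖z‖ ≤ 1 := by simpa using hz
    simp only [mem_ball, dist_zero_right, norm_mul, norm_inv, Complex.norm_real, Real.norm_eq_abs,
      abs_of_pos hρ0]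
    calc ρ⁻¹ * ‖z‖ ≤ ρ⁻¹ * 1 := by gcongr
      _ < 1 := by rw [mul_one]; exact inv_lt_one_of_one_lt₀ hρ1
  refine ⟨fun z ↦ h₀ ((ρ : ℂ)⁻¹ * z), fun z hz ↦ ?_, by simpa using hh₀0, fun z hz ↦ ?_,
    fun z hz ↦ ?_⟩
  · exact (hh₀d.analyticAt (isOpen_ball.mem_nhds (hball z hz))).comp_of_eq
      (analyticAt_const.mul analyticAt_id) rfl
  · have h1 := (hh₀ _ (hball z (sphere_subset_closedBall hz))).1
    rw [hmf] at h1
    exact h1.trans hmρ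
  · have h2 := (hh₀ _ (hball z (sphere_subset_closedBall hz))).2
    rw [hmf] at h2
    have hfz : f ((ρ : ℂ)⁻¹ * z) = g z := by
      simp only [hf]
      rw [← mul_assoc, mul_inv_cancel₀ (by exact_mod_cast hρ0.ne'), one_mul]
    rw [hfz] at h2
    exact h2.trans hmρ

/-! ### 7. Theorem 2.0.1 from its meromorphic form (CDT §2.3) -/

/-- **The abstract holonomy bound from its meromorphic form** (CDT §2.3, opening sentence: "At
this point Theorem 2.0.1 comes as the immediate combination of Lemma 2.0.4 and the following
classical lemma of Nevanlinna", and Remark 2.3.2: the bound of Theorem 2.0.1 is the infimum of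
the bounds of Lemma 2.0.4 over all holomorphic multipliers `h`). Abstractly: let `g` be
holomorphic about the closed unit disc, `L > 0`, and let the real number `m` satisfy the bound of
the meromorphic form for every multiplier — for every `h` holomorphic about the closed unit disc
with `h(0) = 1` and every `M` with `log|h| ≤ M` and `log|h g| ≤ M` on `𝕋`, `m ≤ e M / L`. Then
`m ≤ e · ∫_𝕋 log⁺|g| μ_Haar / L` (apply `exists_holomorphic_multiplier` with `ε → 0`). In CDT,
`g = φ^* p`, `L = log|φ'(0)|` and `m` is the number of `ℚ(p(x))`-linearly independent functions.
[cite: CalegariDimitrovTang2025, §2.3 (proof of Theorem 2.0.1 from Lemma 2.0.4 and Lemma 2.3.1)] -/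
theorem le_of_forall_multiplier_bound {g : ℂ → ℂ} (hg : AnalyticOnNhd ℂ g (closedBall 0 1))
    {m L : ℝ} (hL : 0 < L)
    (hbound : ∀ h : ℂ → ℂ, AnalyticOnNhd ℂ h (closedBall 0 1) → h 0 = 1 → ∀ M : ℝ,
      (∀ z ∈ sphere (0 : ℂ) 1, Real.log ‖h z‖ ≤ M) →
      (∀ z ∈ sphere (0 : ℂ) 1, Real.log ‖h z * g z‖ ≤ M) → m ≤ Real.exp 1 * M / L) :
    m ≤ Real.exp 1 * circleAverage (fun w ↦ log⁺ ‖g w‖) 0 1 / L := by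
  set A := circleAverage (fun w ↦ log⁺ ‖g w‖) 0 1 with hA
  refine le_of_forall_pos_le_add fun ε hε ↦ ?_
  have he : 0 < Real.exp 1 := Real.exp_pos 1
  set ε₀ := ε * L / Real.exp 1 with hε₀
  have hε₀pos : 0 < ε₀ := by positivity
  obtain ⟨h, hh, hh0, hh1, hh2⟩ := exists_holomorphic_multiplier hg hε₀pos
  have := hbound h hh hh0 (A + ε₀) hh1 hh2
  calc m ≤ Real.exp 1 * (A + ε₀) / L := this
    _ = Real.exp 1 * A / L + ε := by
        rw [hε₀]
        field_simp

/-! ### 8. The converse inequality (CDT Remark 2.3.2) -/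

/-- **Sub-mean-value of `log|h|`** (from Jensen's formula): for `h` holomorphic about the closed
unit disc with `h(0) = 1`, `0 ≤ ∫_𝕋 log|h| μ_Haar`. [folklore] -/
theorem circleAverage_log_norm_nonneg_of_map_zero {h : ℂ → ℂ} (hh : AnalyticOnNhd ℂ h (closedBall 0 1))
    (hh0 : h 0 = 1) : 0 ≤ circleAverage (fun w ↦ Real.log ‖h w‖) 0 1 := by
  have hh' : AnalyticOnNhd ℂ h (closedBall 0 |1|) := by rwa [abs_one]
  have hJ := hh'.circleAverage_log_norm one_ne_zero (by simp [hh0])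
  rw [show (fun w ↦ Real.log ‖h w‖) = (Real.log ‖h ·‖) from rfl, hJ, hh0, norm_one, Real.log_one,
    add_zero]
  refine finsum_nonneg fun u ↦ ?_
  by_cases hu : u ∈ closedBall (0 : ℂ) |1|
  · have hdiv : (0 : ℝ) ≤ (MeromorphicOn.divisor h (closedBall 0 |1|) u : ℤ) := by
      exact_mod_cast MeromorphicOn.AnalyticOnNhd.divisor_nonneg hh' u
    refine mul_nonneg hdiv ?_
    have hu1 : ‖u‖ ≤ 1 := by simpa using hu
    rcases (norm_nonneg u).eq_or_lt with h0 | h0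
    · have hu0 : u = 0 := norm_eq_zero.mp h0.symm
      subst hu0
      simp
    · rw [one_mul, zero_sub, norm_neg]
      exact Real.log_nonneg ((one_le_inv₀ h0).mpr hu1)
  · simp [Function.locallyFinsuppWithin.apply_eq_zero_of_notMem _ hu]

/-- **The converse inequality** (CDT Remark 2.3.2): for any `h` holomorphic about the closed unit
disc with `h(0) = 1`, `max { sup_𝕋 log|h|, sup_𝕋 log|hg| } ≥ ∫_𝕋 log⁺|g| μ_Haar` — in the form:
if `log|h| ≤ M` and `log|hg| ≤ M` on `𝕋` then `∫_𝕋 log⁺|g| μ_Haar ≤ M`. "As one sees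
immediately from integrating the pointwise identity `max{log|h|, log|hg|} = log|h| + log⁺|g|` over
`𝕋` and using `∫_𝕋 log|h| ≥ log|h(0)| = 0` from subharmonicity. This shows the necessity of the
`ε` in Lemma 2.3.1" and that Theorem 2.0.1 is equivalent with Lemma 2.0.4.
[cite: CalegariDimitrovTang2025, Remark 2.3.2] -/
theorem circleAverage_posLog_norm_le_of_multiplier {g h : ℂ → ℂ}
    (hg : AnalyticOnNhd ℂ g (closedBall 0 1)) (hh : AnalyticOnNhd ℂ h (closedBall 0 1))
    (hh0 : h 0 = 1) {M : ℝ} (h1 : ∀ z ∈ sphere (0 : ℂ) 1, Real.log ‖h z‖ ≤ M)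
    (h2 : ∀ z ∈ sphere (0 : ℂ) 1, Real.log ‖h z * g z‖ ≤ M) :
    circleAverage (fun w ↦ log⁺ ‖g w‖) 0 1 ≤ M := by
  -- the pointwise bound off the zeros of `h`
  have hpt : ∀ w ∈ sphere (0 : ℂ) 1, h w ≠ 0 → log⁺ ‖g w‖ + Real.log ‖h w‖ ≤ M := by
    intro w hw hhw
    by_cases hgw : ‖g w‖ ≤ 1
    · rw [(posLog_eq_zero_iff _).mpr (by simpa using hgw), zero_add]
      exact h1 w hw
    · push Not at hgw
      have hg0 : g w ≠ 0 := fun h0 ↦ by rw [h0, norm_zero] at hgw; linarith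
      rw [posLog_eq_log (by simpa using hgw.le), add_comm,
        ← Real.log_mul (norm_ne_zero_iff.mpr hhw) (norm_ne_zero_iff.mpr hg0), ← norm_mul]
      exact h2 w hw
  -- continuity / integrability on the circle
  have hgc : ContinuousOn g (sphere (0 : ℂ) 1) := fun w hw ↦
    (hg w (sphere_subset_closedBall hw)).continuousAt.continuousWithinAt
  have hposc : ContinuousOn (fun w ↦ log⁺ ‖g w‖) (sphere (0 : ℂ) 1) :=
    (by fun_prop : Continuous fun x : ℝ ↦ log⁺ x).comp_continuousOn
      (continuous_norm.comp_continuousOn hgc)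
  have hi1 : CircleIntegrable (fun w ↦ log⁺ ‖g w‖) 0 1 := hposc.circleIntegrable zero_le_one
  have hi2 : CircleIntegrable (fun w ↦ Real.log ‖h w‖) 0 1 := by
    have hsub : sphere (0 : ℂ) |1| ⊆ closedBall 0 1 := by rw [abs_one]; exact sphere_subset_closedBall
    exact (hh.mono hsub).meromorphicOn.circleIntegrable_log_norm
  -- the modified integrand `F' = min (log⁺|g| + log|h|) M`, equal to `log⁺|g| + log|h|` off the
  -- (discrete) zero set of `h`
  set F : ℂ → ℝ := fun w ↦ log⁺ ‖g w‖ + Real.log ‖h w‖ with hF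
  have hcod : F =ᶠ[codiscreteWithin (sphere (0 : ℂ) |1|)] fun w ↦ min (F w) M := by
    have hzero : h ⁻¹' {0}ᶜ ∈ codiscreteWithin (closedBall (0 : ℂ) |1|) := by
      refine (show AnalyticOnNhd ℂ h (closedBall 0 |1|) by simpa using hh).preimage_zero_mem_codiscreteWithin
        (x := 0) (by simp [hh0]) (by simp) ?_
      exact (convex_closedBall (0 : ℂ) |1|).isConnected ⟨0, by simp⟩
    have hzero' : h ⁻¹' {0}ᶜ ∈ codiscreteWithin (sphere (0 : ℂ) |1|) :=
      Filter.codiscreteWithin_mono (U := closedBall (0 : ℂ) |1|) sphere_subset_closedBall hzero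
    filter_upwards [hzero', self_mem_codiscreteWithin (sphere (0 : ℂ) |1|)] with w hw hws
    rw [abs_one] at hws
    exact (min_eq_left (hpt w hws hw)).symm
  have hiF : CircleIntegrable F 0 1 := hi1.add hi2
  have havg : circleAverage F 0 1 ≤ M := by
    rw [circleAverage_congr_codiscreteWithin hcod one_ne_zero]
    exact circleAverage_mono_on_of_le_circle (hiF.congr_codiscreteWithin hcod)
      fun w _ ↦ min_le_right _ _
  have hsplit : circleAverage (fun w ↦ log⁺ ‖g w‖) 0 1 =
      circleAverage F 0 1 - circleAverage (fun w ↦ Real.log ‖h w‖) 0 1 := by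
    rw [show F = (fun w ↦ log⁺ ‖g w‖) + fun w ↦ Real.log ‖h w‖ from rfl, circleAverage_add hi1 hi2]
    ring
  rw [hsplit]
  linarith [circleAverage_log_norm_nonneg_of_map_zero hh hh0]

end Literature.Analysis.Complex
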